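import Literature.AlgebraicGeometry.Resolution.NodalFamilyRingSingularLocus
import Literature.AlgebraicGeometry.Resolution.FormalNodeRingSingular
import HarnessLib

/-!
# The formal model `k⟦u, v, t₁, …, t_m⟧/(uv - t₁ ⋯ t_s)` of de Jong 1996, 4.25 (ii): the branches
of its singular locus are nonsingular, and its renumbering symmetries

Topic: `Literature/AlgebraicGeometry/Resolution`. Bottom-up commutative algebra for Claim 4.27 of
de Jong 1996 (`DeJong1996NormalFormPairBlowup`, `AlterationsNormalFormBlowup.lean`), whose proof
begins: "Since `E` is smooth, its ideal in the rings of (ii) is given by `(u, v, t₁, t₂)` after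
renumbering" — complementing `NodalFamilyRingSingularLocus.lean` (the singular locus of
`N = k⟦u, v, t₁, …, t_m⟧/(uv - t₁ ⋯ t_s)`, `DeJong1996.NodalFamilyRing k m s`, is
`⋃_{a<b<s} V(𝔭_{ab})`): (a) the branches `V(𝔭_{ab})` are NONSINGULAR of dimension `m - 2`, and
(b) they are permuted transitively by automorphisms of `N` preserving `u`, `v` and the boundary
equation `t₁ ⋯ t_r`. Everything here is PROVED (over `PowerSeriesRegularLocal.lean`: the variables
of `k⟦X⟧` form a regular system of parameters; `RsopMonomialIdeals.lean`):

* `DeJong1996.NodalFamilyRing.gen i` — the images of the variables in `N` as ONE family over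
  `Fin 2 ⊕ Fin m` (`gen (inl 0) = u`, `gen (inl 1) = v`, `gen (inr i) = t i` of
  `AlterationsNormalFormBlowupFormal.lean`, by `rfl`); the family `(u, v, t_a, t_b)`
  (`FormalNodeRing.quadVars`, `FormalNodeRingSingular.lean`) spans the preimage ideal `𝔓_{ab}`
  (`nodalCentrePreimage`, `NodalFamilyRingSingularLocus.lean`; `span_range_X_quadVars`) and is part
  of a regular system of parameters (`isRsopPart_nodalCentre`, via
  `MvPowerSeries.isRsopPart_X_of_injective`), whence
  `isRegularLocalRing_quotient_nodalCentrePreimage`, `ringKrullDim_quotient_nodalCentrePreimage`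
  and, for `𝔭_{ab} = 𝔓_{ab}/(F) ⊆ N` (`DeJong1996.nodalCentreIdeal`):
  `NodalFamilyRing.isRegularLocalRing_quotient_nodalCentreIdeal`,
  `NodalFamilyRing.ringKrullDim_quotient_nodalCentreIdeal` (`N/𝔭_{ab} ≅ k⟦tᵢ : i ≠ a, b⟧`, regular
  of dimension `m - 2`: the branches of the singular locus are nonsingular, "`Eᵢ` is a regular
  scheme", 3.5); `nodalCentreIdeal_comm`, `gen_mem_nodalCentreIdeal`;
  `NodalFamilyRing.not_isRegularLocalRing_localization_iff` — the singular locus of `N` as an iff,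
  assembled from the two halves of `NodalFamilyRingSingularLocus.lean`. (The parallel development
  for `FormalNodeRing k m ν` — of which `N` is the case `ν = 𝟙_{i<s}`,
  `formalNodeRingEquivNodalFamilyRing` — is `FormalNodeRingSingular.lean`: `singPrime`,
  `isRegularLocalRing_quotient_singPrime`, `not_isRegularLocalRing_localization_singPrime`,
  `exists_singPrime_le_of_not_isRegularLocalRing`, `quotientVarIdealEquiv`; the statements here are
  the ones phrased with `nodalCentreIdeal`, used downstream by `AlterationsNormalFormBlowupFormal.lean`.)
* `DeJong1996.NodalFamilyRing.exists_algEquiv_map_nodalCentreIdeal` — **"after renumbering"**: for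
  two pairs `a ≠ b`, `c ≠ d` of indices below `s` there is a `k`-algebra automorphism of `N`
  (`renumbering`, a permutation of `Fin m` supported below `s`; `renumberSeries`, `renumber`)
  carrying `𝔭_{ab}` to `𝔭_{cd}`, fixing `u`, `v` and the boundary `t₁ ⋯ t_r` for every `r ≥ s`.

## Sources

* A. J. de Jong, *Smoothness, semi-stability and alterations*, Publ. Math. IHÉS 83 (1996) 51–93:
  3.5 (p. 64: "this implies that `Sing(X)` has pure codimension three … `Eᵢ` is a regular
  scheme"), 4.25 (ii) and 4.27 (pp. 75–76). [DeJong1996]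
* H. Matsumura, *Commutative Ring Theory*, CUP 1986, Thm. 14.2 (quotients by parts of a regular
  system of parameters). [Matsumura1987]
-/

noncomputable section

namespace Literature.AlgebraicGeometry.Resolution

universe u

open IsLocalRing

namespace DeJong1996

variable (k : Type u) [Field k] (m s : ℕ)

/-! ## The relation -/

/-- The finite set of indices `i < s` of the `tᵢ` entering the relation `uv - ∏_{i<s} tᵢ`.
[cite: DeJong1996, 4.25 (ii), p. 75] -/
abbrev nodalIndices : Finset (Fin m) := Finset.univ.filter fun i : Fin m => i.val < s

/-- Unfolding the relation: `uv - ∏_{i<s} tᵢ`. [cite: DeJong1996, 4.25 (ii), p. 75] -/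
theorem nodalFamilyRelation_eq : nodalFamilyRelation k m s =
    MvPowerSeries.X (Sum.inl 0) * MvPowerSeries.X (Sum.inl 1) -
      ∏ i ∈ nodalIndices m s, MvPowerSeries.X (Sum.inr i) :=
  rfl

/-! ## The generators of `N` and the branches `(u, v, t_a, t_b)` -/

namespace NodalFamilyRing

/-- The images `u = gen (inl 0)`, `v = gen (inl 1)`, `tᵢ = gen (inr i)` of the variables in
`N = k⟦u, v, t⟧/(uv - ∏_{i<s} tᵢ)`. [cite: DeJong1996, 4.25 (ii), p. 75] -/
def gen (i : Fin 2 ⊕ Fin m) : NodalFamilyRing k m s :=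
  Ideal.Quotient.mk _ (MvPowerSeries.X i)

/-- The relation in `N`: `u v = ∏_{i<s} tᵢ`. [cite: DeJong1996, 4.25 (ii), p. 75] -/
theorem gen_mul_gen_eq_prod :
    gen k m s (Sum.inl 0) * gen k m s (Sum.inl 1) = ∏ i ∈ nodalIndices m s, gen k m s (Sum.inr i) := by
  simp only [gen, ← map_mul, ← map_prod]
  rw [Ideal.Quotient.eq, ← nodalFamilyRelation_eq]
  exact Ideal.subset_span (Set.mem_singleton _)

/-- The boundary equation is the product of the `tᵢ`, `i < r`. [cite: DeJong1996, 4.25 (ii), p. 75] -/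
theorem nodalFamilyBoundary_eq_prod (r : ℕ) :
    nodalFamilyBoundary k m s r = ∏ i ∈ nodalIndices m r, gen k m s (Sum.inr i) := by
  simp only [gen, ← map_prod]
  rfl

end NodalFamilyRing

/-- The ideal generated by the family `(u, v, t_a, t_b)` (`FormalNodeRing.quadVars`,
`FormalNodeRingSingular.lean`) is the preimage ideal `𝔓_{ab}` of `NodalFamilyRingSingularLocus.lean`.
[folklore] -/
theorem span_range_X_quadVars (a b : Fin m) :
    Ideal.span (Set.range fun i => (MvPowerSeries.X (FormalNodeRing.quadVars a b i) :
      MvPowerSeries (Fin 2 ⊕ Fin m) k)) = nodalCentrePreimage k m a b := by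
  rw [nodalCentrePreimage, FormalNodeRing.range_X_quadVars]
  congr 1
  ext φ
  simp [centreVars, Set.image_insert_eq, Set.image_singleton]

/-- For `a ≠ b`, `u, v, t_a, t_b` is part of a regular system of parameters of `k⟦u, v, t⟧`.
[cite: Matsumura1987, Thm. 14.2] -/
theorem isRsopPart_nodalCentre {a b : Fin m} (hab : a ≠ b) :
    IsRsopPart (fun i => (MvPowerSeries.X (FormalNodeRing.quadVars a b i) :
      MvPowerSeries (Fin 2 ⊕ Fin m) k)) :=
  MvPowerSeries.isRsopPart_X_of_injective k _ (FormalNodeRing.quadVars_injective hab)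

/-- `k⟦u, v, t⟧/(u, v, t_a, t_b)` is a regular local ring (`≅ k⟦tᵢ : i ≠ a, b⟧`).
[cite: Matsumura1987, Thm. 14.2] -/
theorem isRegularLocalRing_quotient_nodalCentrePreimage {a b : Fin m} (hab : a ≠ b) :
    IsRegularLocalRing (MvPowerSeries (Fin 2 ⊕ Fin m) k ⧸ nodalCentrePreimage k m a b) :=
  span_range_X_quadVars k m a b ▸ (isRsopPart_nodalCentre k m hab).isRegularLocalRing_quotient

/-- `dim k⟦u, v, t₁, …, t_m⟧/(u, v, t_a, t_b) = m - 2`. [cite: Matsumura1987, Thm. 14.2] -/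
theorem ringKrullDim_quotient_nodalCentrePreimage {a b : Fin m} (hab : a ≠ b) :
    ringKrullDim (MvPowerSeries (Fin 2 ⊕ Fin m) k ⧸ nodalCentrePreimage k m a b) = (m - 2 : ℕ) := by
  have h := (isRsopPart_nodalCentre k m hab).ringKrullDim_quotient_add
  rw [span_range_X_quadVars, ringKrullDim_mvPowerSeries, Nat.card_sum, Nat.card_fin,
    Nat.card_fin] at h
  have h2 : 2 ≤ m := by
    rcases Nat.lt_or_ge m 2 with hm | hm
    · exfalso
      have : Subsingleton (Fin m) := by
        rcases Nat.lt_succ_iff.mp hm with _ | h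
        · infer_instance
        · simp at h; subst h; infer_instance
      exact hab (Subsingleton.elim a b)
    · exact hm
  haveI := isRegularLocalRing_quotient_nodalCentrePreimage k m hab
  obtain ⟨n, hn⟩ := exists_nat_cast_eq_ringKrullDim
    (R := MvPowerSeries (Fin 2 ⊕ Fin m) k ⧸ nodalCentrePreimage k m a b)
  change ringKrullDim (MvPowerSeries (Fin 2 ⊕ Fin m) k ⧸ nodalCentrePreimage k m a b) + 4 = _ at h
  rw [hn] at h ⊢
  have h' : n + 4 = 2 + m := by exact_mod_cast h
  congr 1
  omega

/-- The kernel `(uv - ∏ tᵢ)` of `k⟦u, v, t⟧ → N` lies in `𝔓_{ab}`. [folklore] -/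
theorem span_nodalFamilyRelation_le {a b : Fin m} (hab : a ≠ b) (ha : a.val < s) (hb : b.val < s) :
    Ideal.span {nodalFamilyRelation k m s} ≤ nodalCentrePreimage k m a b := by
  rw [Ideal.span_le, Set.singleton_subset_iff]
  exact nodalFamilyRelation_mem k m s hab ha hb

namespace NodalFamilyRing

/-- `gen` on `u`. [folklore] -/
@[simp] theorem gen_inl_zero : gen k m s (Sum.inl 0) = u k m s := rfl

/-- `gen` on `v`. [folklore] -/
@[simp] theorem gen_inl_one : gen k m s (Sum.inl 1) = v k m s := rfl

/-- `gen` on `tᵢ`. [folklore] -/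
@[simp] theorem gen_inr (i : Fin m) : gen k m s (Sum.inr i) = t k m s i := rfl

/-- `𝔭_{ab} ⊆ N` is the image of `𝔓_{ab} ⊆ k⟦u, v, t⟧` (`map_mk_nodalCentrePreimage` of
`NodalFamilyRingSingularLocus.lean`, restated in the orientation used below). [folklore] -/
theorem nodalCentreIdeal_eq_map (a b : Fin m) :
    nodalCentreIdeal k m s a b = (nodalCentrePreimage k m a b).map (Ideal.Quotient.mk _) :=
  (map_mk_nodalCentrePreimage k m s a b).symm

/-- `𝔭_{ab} = 𝔭_{ba}`. [folklore] -/
theorem nodalCentreIdeal_comm (a b : Fin m) :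
    nodalCentreIdeal k m s a b = nodalCentreIdeal k m s b a := by
  change Ideal.span _ = Ideal.span _
  rw [Set.pair_comm (t k m s a) (t k m s b)]

/-- The generators `u, v, t_a, t_b` lie in `𝔭_{ab}`. [folklore] -/
theorem gen_mem_nodalCentreIdeal (a b : Fin m) (i : Fin 4) :
    gen k m s (FormalNodeRing.quadVars a b i) ∈ nodalCentreIdeal k m s a b := by
  rw [nodalCentreIdeal_eq_map]
  refine Ideal.mem_map_of_mem _ (X_mem_nodalCentrePreimage k ?_)
  fin_cases i <;> simp [FormalNodeRing.quadVars, centreVars]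

/-- `N/𝔭_{ab} ≅ k⟦u, v, t⟧/𝔓_{ab}`. [folklore] -/
def quotientNodalCentreIdealEquiv {a b : Fin m} (hab : a ≠ b) (ha : a.val < s) (hb : b.val < s) :
    NodalFamilyRing k m s ⧸ nodalCentreIdeal k m s a b ≃+*
      MvPowerSeries (Fin 2 ⊕ Fin m) k ⧸ nodalCentrePreimage k m a b :=
  (Ideal.quotEquivOfEq (nodalCentreIdeal_eq_map k m s a b)).trans
    (DoubleQuot.quotQuotEquivQuotOfLE (span_nodalFamilyRelation_le k m s hab ha hb))

/-- **The branches of the singular locus are nonsingular**: `N/𝔭_{ab}` is a regular local ring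
("`Eᵢ` is a regular scheme", 3.5). [cite: DeJong1996, 3.5, p. 64] -/
theorem isRegularLocalRing_quotient_nodalCentreIdeal {a b : Fin m} (hab : a ≠ b) (ha : a.val < s)
    (hb : b.val < s) : IsRegularLocalRing (NodalFamilyRing k m s ⧸ nodalCentreIdeal k m s a b) :=
  haveI := isRegularLocalRing_quotient_nodalCentrePreimage k m hab
  IsRegularLocalRing.of_ringEquiv (quotientNodalCentreIdealEquiv k m s hab ha hb).symm

/-- `dim N/𝔭_{ab} = m - 2` ("`Sing(X)` has pure codimension three in `X`", 3.5, as
`dim N = m + 1`). [cite: DeJong1996, 3.5, p. 64] -/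
theorem ringKrullDim_quotient_nodalCentreIdeal {a b : Fin m} (hab : a ≠ b) (ha : a.val < s)
    (hb : b.val < s) :
    ringKrullDim (NodalFamilyRing k m s ⧸ nodalCentreIdeal k m s a b) = (m - 2 : ℕ) := by
  rw [ringKrullDim_eq_of_ringEquiv (quotientNodalCentreIdealEquiv k m s hab ha hb),
    ringKrullDim_quotient_nodalCentrePreimage k m hab]

/-! ## The singular locus of `N`, assembled -/

/-- **The singular locus of `N`, as an iff** (the two halves of
`NodalFamilyRingSingularLocus.lean`): for `2 ≤ s ≤ m`, `N_𝔮` is singular iff `𝔮 ⊇ 𝔭_{ab}` for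
some `a < b < s`. [cite: DeJong1996, 3.5 and 4.27, pp. 64, 75] -/
theorem not_isRegularLocalRing_localization_iff (hs : 2 ≤ s) (hsm : s ≤ m)
    (Q : Ideal (NodalFamilyRing k m s)) [Q.IsPrime] :
    ¬ IsRegularLocalRing (Localization.AtPrime Q) ↔
      ∃ a b : Fin m, a < b ∧ b.val < s ∧ nodalCentreIdeal k m s a b ≤ Q := by
  refine ⟨exists_nodalCentreIdeal_le_of_not_isRegularLocalRing k m s hs hsm Q, ?_⟩
  rintro ⟨a, b, hab, hb, hle⟩
  exact not_isRegularLocalRing_of_nodalCentreIdeal_le k m s hsm hab.ne (lt_trans hab hb) hb Q hle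

/-- A singular prime of `N` contains `u` and `v`. [folklore] -/
theorem gen_inl_mem_of_not_isRegularLocalRing (hs : 2 ≤ s) (hsm : s ≤ m)
    (Q : Ideal (NodalFamilyRing k m s)) [Q.IsPrime]
    (hQ : ¬ IsRegularLocalRing (Localization.AtPrime Q)) (j : Fin 2) : gen k m s (Sum.inl j) ∈ Q := by
  obtain ⟨a, b, -, -, hle⟩ := exists_nodalCentreIdeal_le_of_not_isRegularLocalRing k m s hs hsm Q hQ
  fin_cases j
  · exact hle (gen_mem_nodalCentreIdeal k m s a b 0)
  · exact hle (gen_mem_nodalCentreIdeal k m s a b 1)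

end NodalFamilyRing

/-! ## "After renumbering": the branches are conjugate under automorphisms of `N` -/

section Renumbering

variable {m}

/-- The renumbering of the indices: a permutation of `Fin m` taking `a ↦ c`, `b ↦ d` and
fixing every index `≥ s` (when `a, b, c, d < s`): swap `a, c`, then swap the image of `b` with
`d`. [folklore] -/
def renumbering (a b c d : Fin m) : Equiv.Perm (Fin m) :=
  (Equiv.swap a c).trans (Equiv.swap (Equiv.swap a c b) d)

variable {a b c d : Fin m}

/-- `renumbering a b c d a = c` (for `a ≠ b`, `c ≠ d`). [folklore] -/
theorem renumbering_apply_left (hab : a ≠ b) (hcd : c ≠ d) : renumbering a b c d a = c := by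
  simp only [renumbering, Equiv.trans_apply, Equiv.swap_apply_left]
  apply Equiv.swap_apply_of_ne_of_ne _ hcd
  intro h
  have : b = a := by
    have := congrArg (Equiv.swap a c) h
    rwa [Equiv.swap_apply_self, Equiv.swap_apply_right, eq_comm] at this
  exact hab this.symm

/-- `renumbering a b c d b = d`. [folklore] -/
theorem renumbering_apply_right : renumbering a b c d b = d := by
  simp only [renumbering, Equiv.trans_apply, Equiv.swap_apply_left]

/-- The renumbering fixes every index `≥ s` (when `a, b, c, d < s`). [folklore] -/
theorem renumbering_apply_of_le (ha : a.val < s) (hb : b.val < s) (hc : c.val < s)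
    (hd : d.val < s) {i : Fin m} (hi : s ≤ i.val) : renumbering a b c d i = i := by
  have hia : i ≠ a := fun h => by subst h; omega
  have hic : i ≠ c := fun h => by subst h; omega
  have hid : i ≠ d := fun h => by subst h; omega
  have hib : i ≠ Equiv.swap a c b := by
    intro h
    rcases eq_or_ne b a with hba | hba
    · rw [hba, Equiv.swap_apply_left] at h
      exact hic h
    rcases eq_or_ne b c with hbc | hbc
    · rw [hbc, Equiv.swap_apply_right] at h
      exact hia h
    · rw [Equiv.swap_apply_of_ne_of_ne hba hbc] at h
      subst h
      omega
  simp only [renumbering, Equiv.trans_apply, Equiv.swap_apply_of_ne_of_ne hia hic,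
    Equiv.swap_apply_of_ne_of_ne hib hid]

/-- The renumbering preserves `{i | i < r}` for every `r ≥ s`. [folklore] -/
theorem renumbering_lt_iff (ha : a.val < s) (hb : b.val < s) (hc : c.val < s) (hd : d.val < s)
    {r : ℕ} (hsr : s ≤ r) (i : Fin m) : (renumbering a b c d i).val < r ↔ i.val < r := by
  by_cases hi : s ≤ i.val
  · rw [renumbering_apply_of_le s ha hb hc hd hi]
  · have his : i.val < s := lt_of_not_ge hi
    refine ⟨fun _ => lt_of_lt_of_le his hsr, fun _ => lt_of_lt_of_le ?_ hsr⟩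
    -- `π` fixes the complement of `{< s}` pointwise, so it maps `{< s}` into itself
    by_contra h
    have hfix := renumbering_apply_of_le s ha hb hc hd (le_of_not_gt h) (a := a) (b := b) (c := c) (d := d)
    have := (renumbering a b c d).injective hfix
    rw [← this] at his
    exact h his

variable (m)

/-- The automorphism of `k⟦u, v, t⟧` renaming the `tᵢ` along the renumbering (and fixing `u, v`).
[cite: DeJong1996, 4.27, p. 75] -/
def renumberSeries (a b c d : Fin m) :
    MvPowerSeries (Fin 2 ⊕ Fin m) k ≃ₐ[k] MvPowerSeries (Fin 2 ⊕ Fin m) k :=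
  MvPowerSeries.renameEquiv k (Equiv.sumCongr (Equiv.refl (Fin 2)) (renumbering a b c d))

/-- The renaming on `u, v`. [folklore] -/
@[simp]
theorem renumberSeries_X_inl (j : Fin 2) :
    renumberSeries k m a b c d (MvPowerSeries.X (Sum.inl j)) = MvPowerSeries.X (Sum.inl j) := by
  simp [renumberSeries, MvPowerSeries.rename_X]

/-- The renaming on the `tᵢ`. [folklore] -/
@[simp]
theorem renumberSeries_X_inr (i : Fin m) :
    renumberSeries k m a b c d (MvPowerSeries.X (Sum.inr i)) =
      MvPowerSeries.X (Sum.inr (renumbering a b c d i)) := by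
  simp [renumberSeries, MvPowerSeries.rename_X]

/-- The renaming fixes `∏_{i<r} tᵢ` for every `r ≥ s`. [folklore] -/
theorem renumberSeries_prod (ha : a.val < s) (hb : b.val < s) (hc : c.val < s) (hd : d.val < s)
    {r : ℕ} (hsr : s ≤ r) :
    renumberSeries k m a b c d (∏ i ∈ nodalIndices m r, MvPowerSeries.X (Sum.inr i)) =
      ∏ i ∈ nodalIndices m r, MvPowerSeries.X (Sum.inr i) := by
  rw [map_prod]
  simp only [renumberSeries_X_inr]
  exact Finset.prod_equiv (renumbering a b c d) (fun i => by
    simp [renumbering_lt_iff s ha hb hc hd hsr i]) (fun i _ => rfl)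

/-- The renaming fixes the relation `uv - ∏_{i<s} tᵢ`. [cite: DeJong1996, 4.27, p. 75] -/
theorem renumberSeries_nodalFamilyRelation (ha : a.val < s) (hb : b.val < s) (hc : c.val < s)
    (hd : d.val < s) :
    renumberSeries k m a b c d (nodalFamilyRelation k m s) = nodalFamilyRelation k m s := by
  rw [nodalFamilyRelation_eq, map_sub, map_mul, renumberSeries_X_inl, renumberSeries_X_inl,
    renumberSeries_prod k m s ha hb hc hd le_rfl]

/-- The ideal of the relation is stable under the renaming. [folklore] -/
theorem span_eq_map_renumberSeries (ha : a.val < s) (hb : b.val < s) (hc : c.val < s)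
    (hd : d.val < s) :
    Ideal.span {nodalFamilyRelation k m s} =
      (Ideal.span {nodalFamilyRelation k m s}).map
        (renumberSeries k m a b c d : MvPowerSeries (Fin 2 ⊕ Fin m) k →+* _) := by
  rw [Ideal.map_span, Set.image_singleton]
  change _ = Ideal.span {renumberSeries k m a b c d (nodalFamilyRelation k m s)}
  rw [renumberSeries_nodalFamilyRelation k m s ha hb hc hd]

namespace NodalFamilyRing

/-- **The renumbering automorphism of `N`** induced by renaming the `tᵢ`.
[cite: DeJong1996, 4.27, p. 75] -/
def renumber (ha : a.val < s) (hb : b.val < s) (hc : c.val < s) (hd : d.val < s) :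
    NodalFamilyRing k m s ≃ₐ[k] NodalFamilyRing k m s :=
  Ideal.quotientEquivAlg _ _ (renumberSeries k m a b c d) (span_eq_map_renumberSeries k m s ha hb hc hd)

variable (ha : a.val < s) (hb : b.val < s) (hc : c.val < s) (hd : d.val < s)

/-- The renumbering on generators. [folklore] -/
theorem renumber_gen (i : Fin 2 ⊕ Fin m) :
    renumber k m s ha hb hc hd (gen k m s i) =
      gen k m s (Equiv.sumCongr (Equiv.refl (Fin 2)) (renumbering a b c d) i) := by
  rw [gen, renumber, Ideal.quotientEquivAlg_mk]
  cases i with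
  | inl j => simp [gen]
  | inr i => simp [gen]

/-- The renumbering fixes `u` and `v` (family form). [folklore] -/
theorem renumber_gen_inl (j : Fin 2) :
    renumber k m s ha hb hc hd (gen k m s (Sum.inl j)) = gen k m s (Sum.inl j) := by
  rw [renumber_gen]
  rfl

/-- The renumbering on `tᵢ` (family form). [folklore] -/
theorem renumber_gen_inr (i : Fin m) :
    renumber k m s ha hb hc hd (gen k m s (Sum.inr i)) = gen k m s (Sum.inr (renumbering a b c d i)) := by
  rw [renumber_gen]
  rfl

/-- The renumbering fixes `u`. [folklore] -/
@[simp]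
theorem renumber_u : renumber k m s ha hb hc hd (u k m s) = u k m s :=
  renumber_gen_inl k m s ha hb hc hd 0

/-- The renumbering fixes `v`. [folklore] -/
@[simp]
theorem renumber_v : renumber k m s ha hb hc hd (v k m s) = v k m s :=
  renumber_gen_inl k m s ha hb hc hd 1

/-- The renumbering on `tᵢ`: `t i ↦ t (π i)`. [folklore] -/
@[simp]
theorem renumber_t (i : Fin m) :
    renumber k m s ha hb hc hd (t k m s i) = t k m s (renumbering a b c d i) :=
  renumber_gen_inr k m s ha hb hc hd i

/-- **The renumbering fixes the boundary equation** `t₁ ⋯ t_r` for every `r ≥ s`.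
[cite: DeJong1996, 4.27, p. 75] -/
theorem renumber_nodalFamilyBoundary {r : ℕ} (hsr : s ≤ r) :
    renumber k m s ha hb hc hd (nodalFamilyBoundary k m s r) = nodalFamilyBoundary k m s r := by
  change renumber k m s ha hb hc hd (Ideal.Quotient.mk _ _) = Ideal.Quotient.mk _ _
  rw [renumber, Ideal.quotientEquivAlg_mk]
  change Ideal.Quotient.mk _ (renumberSeries k m a b c d _) = _
  rw [renumberSeries_prod k m s ha hb hc hd hsr]

/-- The renumbering fixes the boundary ideal `(t₁ ⋯ t_r)`, `r ≥ s`. [folklore] -/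
theorem map_renumber_span_nodalFamilyBoundary {r : ℕ} (hsr : s ≤ r) :
    (Ideal.span {nodalFamilyBoundary k m s r}).map (renumber k m s ha hb hc hd) =
      Ideal.span {nodalFamilyBoundary k m s r} := by
  rw [Ideal.map_span, Set.image_singleton, renumber_nodalFamilyBoundary k m s ha hb hc hd hsr]

/-- **The renumbering carries `(u, v, t_a, t_b)` to `(u, v, t_c, t_d)`** (`a ≠ b`, `c ≠ d`).
[cite: DeJong1996, 4.27, p. 75] -/
theorem map_renumber_nodalCentreIdeal (hab : a ≠ b) (hcd : c ≠ d) :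
    (nodalCentreIdeal k m s a b).map (renumber k m s ha hb hc hd) = nodalCentreIdeal k m s c d := by
  change (Ideal.span _).map _ = Ideal.span _
  rw [Ideal.map_span]
  simp only [Set.image_insert_eq, Set.image_singleton, renumber_u, renumber_v, renumber_t,
    renumbering_apply_left hab hcd, renumbering_apply_right]

include ha hb hc hd in
/-- **"Since `E` is smooth, its ideal in the rings of (ii) is given by `(u, v, t₁, t₂)` after
renumbering"** — the renumbering part: any two branches `(u, v, t_a, t_b)`, `(u, v, t_c, t_d)`
(`a ≠ b`, `c ≠ d`, all `< s`) of the singular locus of `N` are conjugate under a `k`-algebra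
automorphism of `N` which fixes `u`, `v` and the boundary equation `t₁ ⋯ t_r` for every
`r ≥ s` (so that an isomorphism `𝒪̂_{X,x} ≅ N` as in 4.25 (ii) may be composed with it without
changing the image `(t₁ ⋯ t_r)` of the ideal of `Z`). [cite: DeJong1996, 4.27, p. 75] -/
theorem exists_algEquiv_map_nodalCentreIdeal (hab : a ≠ b) (hcd : c ≠ d) :
    ∃ τ : NodalFamilyRing k m s ≃ₐ[k] NodalFamilyRing k m s,
      (nodalCentreIdeal k m s a b).map τ = nodalCentreIdeal k m s c d ∧
        (∀ j : Fin 2, τ (gen k m s (Sum.inl j)) = gen k m s (Sum.inl j)) ∧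
          ∀ r : ℕ, s ≤ r → τ (nodalFamilyBoundary k m s r) = nodalFamilyBoundary k m s r :=
  ⟨renumber k m s ha hb hc hd, map_renumber_nodalCentreIdeal k m s ha hb hc hd hab hcd,
    renumber_gen_inl k m s ha hb hc hd, fun _ hsr => renumber_nodalFamilyBoundary k m s ha hb hc hd hsr⟩

end NodalFamilyRing

end Renumbering

end DeJong1996

end Literature.AlgebraicGeometry.Resolution

end
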